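import Literature.Geometry.Riemannian.MetricFlowPhiLipschitz
import Literature.Geometry.Riemannian.WassersteinW1Prokhorov
import Mathlib.Topology.MetricSpace.Lipschitz
import HarnessLib

/-!
# The gradient property of the `𝔽`-limit flow (Bamler 2023, §5.4, Lemma 5.20, Claim 5.22)

R. Bamler, *Compactness theory of the space of super Ricci flows*, Invent. Math. 233 (2023), §5.4,
proof of Lemma 5.20 (arXiv v1 Lemma 121), Claim 5.22 (arXiv v1 Claim 123), the verification of
Property (6) of Def. 3.2 (the gradient property) for the limit `𝒳^∞`: *"To see Property (6) let
`s, t ∈ I ∖ E^∞`, `s < t`, `T > 0` and consider a `T^{-1}`-Lipschitz function `f : X^∞_s → ℝ`.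
… It follows that the functions `hⁱ : 𝒳ⁱ_t → ℝ`, `x ↦ Φ⁻¹(∫ (Φ ∘ f̂ ∘ φⁱ_s) dνⁱ_{x;s})` are
`(t − s + T)^{-1}`-Lipschitz. By Claim 5.21 for any `xⁱ ∈ 𝒳ⁱ_t` with `φⁱ_t(xⁱ) → x^∞ ∈ X^∞_t` we
have `hⁱ(xⁱ) → Φ⁻¹(∫ Φ(f) dν_{x^∞;s})`. This shows that `X^∞_t → ℝ`,
`x ↦ Φ⁻¹(∫ Φ(f) dν^∞_{x^∞;s})` is `(t − s + T)^{-1}`-Lipschitz, and therefore Property (6) if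
`T > 0`."*

We prove this passage to the limit in abstract form
(`const_or_exists_lipschitz_of_kernel_limit`): the time-`s` and time-`t` slices of the
approximants are metric spaces `Xs n`, `Xt n`, isometrically embedded by `φs n`, `φt n` into the
comparison spaces `Zs`, `Zt`; the conjugate heat kernels `νⁿ_{·;s}` on `𝒳ⁿ_t` are probability
kernels `κ n : Xt n → Measure (Xs n)` satisfying the gradient property of the tree's
`MetricFlow` (Def. 3.2 (6) in the form "`x ↦ ∫ Φ ∘ f dνⁿ_{x;s}` is constant or equals `Φ ∘ f'`
with `f'` `L`-Lipschitz, for every `K`-Lipschitz `f`"); the limit slice is a subset `St ⊆ Zt`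
whose points are limits `φt n (xn n) → x`, and the limit kernels `ν^∞_{x;s}` are probability
measures `νinf x` on `Zs` which are `W₁`-limits of the push-forwards `(φs n)_* νⁿ_{xn n;s}` along
every such sequence (Claim 5.21). Conclusion: for a `K`-Lipschitz `f : Zs → ℝ`, the function
`x ↦ ∫ Φ ∘ f dν^∞_{x;s}` is constant on `St` or of the form `Φ ∘ f'` on `St` with `f' : Zt → ℝ`
`L`-Lipschitz. As in the printed proof, for `x, x' ∈ St` with approximants `xn, xn'` the
per-`n` bound `|Φ⁻¹(gⁿ(xn n)) − Φ⁻¹(gⁿ(xn' n))| ≤ L d(xn n, xn' n)` (trivial in the constant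
alternative) passes to the limit because `gⁿ(xn n) → g(x) ∈ (0, 1)` (`W₁`-convergence tested
against the bounded continuous `Φ ∘ f`, `Φ⁻¹` continuous on `(0, 1)`); the values lie in
`(0, 1)` since `Φ ∈ (0, 1)` and all measures are probability measures. The `L`-Lipschitz
function `Φ⁻¹ ∘ g` on `St` is then extended to `Zt` (McShane, `LipschitzOnWith.extend_real`).

## References

* R. H. Bamler, *Compactness theory of the space of super Ricci flows*, Invent. Math. 233 (2023),
  1121–1277 (arXiv:2008.09298), §5.4, Lemma 5.20, Claims 5.21–5.22 (arXiv v1 Lemma 121,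
  Claims 122–123); §3.1, Def. 3.2 (6). [Bamler2023]
-/

noncomputable section

open Set MeasureTheory Filter TopologicalSpace Function
open scoped Topology ENNReal NNReal

namespace Literature.Geometry.Riemannian

universe u

open MetricFlow

/-- The integral of `Φ ∘ u` against a probability measure lies in `(0, 1)` (`Φ` takes values in
`(0, 1)`, `u` continuous). [folklore] -/
private theorem integral_Phi_comp_mem_Ioo {X : Type*} [TopologicalSpace X] [MeasurableSpace X]
    [OpensMeasurableSpace X] (μ : Measure X) [IsProbabilityMeasure μ] {u : X → ℝ}
    (hu : Continuous u) : ∫ x, Phi (u x) ∂μ ∈ Ioo (0 : ℝ) 1 := by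
  have hc : Continuous fun x ↦ Phi (u x) := differentiable_Phi.continuous.comp hu
  have hi : Integrable (fun x ↦ Phi (u x)) μ :=
    Integrable.of_bound hc.aestronglyMeasurable 1 (Eventually.of_forall fun x ↦ by
      rw [Real.norm_eq_abs, abs_of_pos (Phi_pos _)]; exact (Phi_lt_one _).le)
  have hi' : Integrable (fun x ↦ 1 - Phi (u x)) μ := (integrable_const 1).sub hi
  constructor
  · rw [integral_pos_iff_support_of_nonneg (fun x ↦ (Phi_pos _).le) hi]
    have hs : (support fun x ↦ Phi (u x)) = univ :=
      eq_univ_of_forall fun x ↦ (Phi_pos (u x)).ne'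
    rw [hs, measure_univ]; exact one_pos
  · have hpos : 0 < ∫ x, (1 - Phi (u x)) ∂μ := by
      rw [integral_pos_iff_support_of_nonneg (fun x ↦ sub_nonneg.2 (Phi_lt_one _).le) hi']
      have hs : (support fun x ↦ 1 - Phi (u x)) = univ :=
        eq_univ_of_forall fun x ↦ (sub_pos.2 (Phi_lt_one (u x))).ne'
      rw [hs, measure_univ]; exact one_pos
    rw [integral_sub (integrable_const 1) hi, integral_const, smul_eq_mul, mul_one] at hpos
    simp only [probReal_univ] at hpos
    linarith

/-- `W₁`-convergence of probability measures on a separable metric space gives convergence of the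
integrals of a bounded continuous test function (through weak convergence,
`ProbabilityMeasure.tendsto_of_tendsto_wassersteinW1`). [folklore] -/
private theorem tendsto_integral_of_tendsto_wassersteinW1 {X : Type*} [MetricSpace X]
    [MeasurableSpace X] [BorelSpace X] [SecondCountableTopology X] {α : ℕ → Measure X}
    {αinf : Measure X} (hP : ∀ n, IsProbabilityMeasure (α n)) [IsProbabilityMeasure αinf]
    (hα : Tendsto (fun n ↦ wassersteinW1 (α n) αinf) atTop (𝓝 0)) {u : X → ℝ}
    (huc : Continuous u) {C : ℝ} (hC : ∀ x y, dist (u x) (u y) ≤ C) :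
    Tendsto (fun n ↦ ∫ x, u x ∂α n) atTop (𝓝 (∫ x, u x ∂αinf)) := by
  have h := ProbabilityMeasure.tendsto_of_tendsto_wassersteinW1
    (μs := fun n ↦ (⟨α n, hP n⟩ : ProbabilityMeasure X)) (μ := ⟨αinf, inferInstance⟩) hα
  exact (ProbabilityMeasure.tendsto_iff_forall_integral_tendsto.1 h)
    (BoundedContinuousFunction.mkOfBound ⟨u, huc⟩ C hC)

/-- **Bamler 2023, Claim 5.22 (arXiv v1 Claim 123), the gradient property (Def. 3.2 (6), `T > 0`)
of the limit flow.** Abstract form, times `s < t`: `Xs n`, `Xt n` are the slices `𝒳ⁿ_s`, `𝒳ⁿ_t`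
of the approximants, embedded by the isometric embeddings `φs n`, `φt n` into the comparison
spaces `Zs`, `Zt`; `κ n = νⁿ_{·;s}` are their conjugate heat kernels on `𝒳ⁿ_t`, probability
kernels with the gradient property for the pair of constants `(K, L)` (`hgrad`: for every
`K`-Lipschitz `f`, `x ↦ ∫ Φ ∘ f dνⁿ_{x;s}` is constant or equals `Φ ∘ f'` with `f'`
`L`-Lipschitz); `St = X^∞_t ⊆ Zt` is the limit slice, whose points are limits of points of the
`φt n (𝒳ⁿ_t)` (`happrox`), and `νinf x = ν^∞_{x;s}` (`x ∈ St`) are probability measures which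
are `W₁`-limits of `(φs n)_* νⁿ_{xn n;s}` along every sequence `φt n (xn n) → x` (`hconv`,
Claim 5.21). Then for every `K`-Lipschitz `f : Zs → ℝ`, the function `x ↦ ∫ Φ ∘ f dν^∞_{x;s}`
is constant on `St`, or there is an `L`-Lipschitz `f' : Zt → ℝ` with
`∫ Φ ∘ f dν^∞_{x;s} = Φ (f' x)` for all `x ∈ St`.
[cite: Bamler2023, §5.4, Lemma 5.20, Claim 5.22 (arXiv v1 Claim 123)] -/
theorem const_or_exists_lipschitz_of_kernel_limit
    {Zs Zt : Type u} [MetricSpace Zs] [MeasurableSpace Zs] [BorelSpace Zs]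
    [SecondCountableTopology Zs] [MetricSpace Zt]
    {Xs Xt : ℕ → Type u} [∀ n, MetricSpace (Xs n)] [∀ n, MeasurableSpace (Xs n)]
    [∀ n, BorelSpace (Xs n)] [∀ n, SecondCountableTopology (Xs n)] [∀ n, MetricSpace (Xt n)]
    (φs : ∀ n, Xs n → Zs) (φt : ∀ n, Xt n → Zt) (hφs : ∀ n, Isometry (φs n))
    (hφt : ∀ n, Isometry (φt n))
    (κ : ∀ n, Xt n → Measure (Xs n)) [∀ n x, IsProbabilityMeasure (κ n x)]
    -- the gradient property of the approximants for the pair of constants `(K, L)`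
    {K L : ℝ≥0}
    (hgrad : ∀ n (f : Xs n → ℝ), LipschitzWith K f →
      (∃ c, ∀ x, ∫ y, MetricFlow.Phi (f y) ∂κ n x = c) ∨
        ∃ f' : Xt n → ℝ, LipschitzWith L f' ∧ ∀ x, ∫ y, MetricFlow.Phi (f y) ∂κ n x =
          MetricFlow.Phi (f' x))
    -- the limit slice `X_t ⊆ Z_t`, its points are limits of points, the limit kernels
    (St : Set Zt) (happrox : ∀ x ∈ St, ∃ xn : ∀ n, Xt n, Tendsto (fun n ↦ φt n (xn n)) atTop (𝓝 x))
    (νinf : Zt → Measure Zs) (hνP : ∀ x ∈ St, IsProbabilityMeasure (νinf x))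
    (hconv : ∀ x ∈ St, ∀ xn : ∀ n, Xt n, Tendsto (fun n ↦ φt n (xn n)) atTop (𝓝 x) →
      Tendsto (fun n ↦ wassersteinW1 ((κ n (xn n)).map (φs n)) (νinf x)) atTop (𝓝 0))
    (f : Zs → ℝ) (hf : LipschitzWith K f) :
    (∃ c, ∀ x ∈ St, ∫ z, MetricFlow.Phi (f z) ∂νinf x = c) ∨
      ∃ f' : Zt → ℝ, LipschitzWith L f' ∧ ∀ x ∈ St, ∫ z, MetricFlow.Phi (f z) ∂νinf x =
        MetricFlow.Phi (f' x) := by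
  -- the bounded continuous test function `Φ ∘ f`
  have hΦf : Continuous fun z ↦ Phi (f z) := differentiable_Phi.continuous.comp hf.continuous
  have hΦf1 : ∀ z z', dist (Phi (f z)) (Phi (f z')) ≤ 1 := fun z z' ↦ by
    rw [Real.dist_eq]
    have h1 := Phi_pos (f z); have h2 := Phi_lt_one (f z)
    have h3 := Phi_pos (f z'); have h4 := Phi_lt_one (f z')
    exact abs_sub_le_iff.2 ⟨by linarith, by linarith⟩
  -- `g x := ∫ Φ ∘ f dν^∞_{x;s} ∈ (0, 1)` for `x ∈ X_t`
  have hg01 : ∀ x ∈ St, ∫ z, Phi (f z) ∂νinf x ∈ Ioo (0 : ℝ) 1 := fun x hx ↦ by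
    haveI := hνP x hx
    exact integral_Phi_comp_mem_Ioo (νinf x) hf.continuous
  -- `gⁿ (xn n) → g x` along approximating sequences (Claim 5.21 tested against `Φ ∘ f`)
  have hlim : ∀ x ∈ St, ∀ xn : ∀ n, Xt n, Tendsto (fun n ↦ φt n (xn n)) atTop (𝓝 x) →
      Tendsto (fun n ↦ ∫ y, Phi (f (φs n y)) ∂κ n (xn n)) atTop
        (𝓝 (∫ z, Phi (f z) ∂νinf x)) := by
    intro x hx xn hxn
    haveI := hνP x hx
    have hmap : ∀ n, ∫ y, Phi (f (φs n y)) ∂κ n (xn n) =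
        ∫ z, Phi (f z) ∂(κ n (xn n)).map (φs n) := fun n ↦
      (integral_map (hφs n).continuous.measurable.aemeasurable hΦf.aestronglyMeasurable).symm
    simp only [hmap]
    exact tendsto_integral_of_tendsto_wassersteinW1
      (fun n ↦ Measure.isProbabilityMeasure_map (hφs n).continuous.measurable.aemeasurable)
      (hconv x hx xn hxn) hΦf hΦf1
  -- the pairwise Lipschitz bound for `Φ⁻¹ ∘ g` on `X_t`
  have hkey : ∀ x ∈ St, ∀ x' ∈ St,
      dist (PhiInv (∫ z, Phi (f z) ∂νinf x)) (PhiInv (∫ z, Phi (f z) ∂νinf x')) ≤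
        L * dist x x' := by
    intro x hx x' hx'
    obtain ⟨xn, hxn⟩ := happrox x hx
    obtain ⟨xn', hxn'⟩ := happrox x' hx'
    -- per `n`: `|hⁿ(xn n) − hⁿ(xn' n)| ≤ L d_t(xn n, xn' n)` (gradient property of `𝒳ⁿ`)
    have hn : ∀ n, dist (PhiInv (∫ y, Phi (f (φs n y)) ∂κ n (xn n)))
        (PhiInv (∫ y, Phi (f (φs n y)) ∂κ n (xn' n))) ≤
          L * dist (φt n (xn n)) (φt n (xn' n)) := by
      intro n
      rw [(hφt n).dist_eq]
      have hfn : LipschitzWith K fun y ↦ f (φs n y) := by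
        simpa only [mul_one, Function.comp_def] using hf.comp (hφs n).lipschitz
      rcases hgrad n (fun y ↦ f (φs n y)) hfn with ⟨c, hc⟩ | ⟨f', hf'L, hf'⟩
      · rw [hc, hc, dist_self]; positivity
      · rw [hf', hf', PhiInv_Phi, PhiInv_Phi]; exact hf'L.dist_le_mul _ _
    -- pass to the limit
    have h1 := tendsto_PhiInv_comp (hg01 x hx).1 (hg01 x hx).2 (hlim x hx xn hxn)
    have h2 := tendsto_PhiInv_comp (hg01 x' hx').1 (hg01 x' hx').2 (hlim x' hx' xn' hxn')
    exact le_of_tendsto_of_tendsto' (h1.dist h2) ((hxn.dist hxn').const_mul (L : ℝ)) hn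
  -- extend `Φ⁻¹ ∘ g` from `X_t` to an `L`-Lipschitz function on `Z_t`
  obtain ⟨f', hf'L, hf'eq⟩ :=
    (LipschitzOnWith.of_dist_le_mul hkey :
      LipschitzOnWith L (fun x ↦ PhiInv (∫ z, Phi (f z) ∂νinf x)) St).extend_real
  refine Or.inr ⟨f', hf'L, fun x hx ↦ ?_⟩
  rw [← hf'eq hx, Phi_PhiInv (hg01 x hx).1 (hg01 x hx).2]

end Literature.Geometry.Riemannian

end
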